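import Summits.BirchSwinnertonDyer.BirchSwinnertonDyer.Theorems.PrintCf2RubinValueTwoKatoThetaNormChain
import HarnessLib

/-!
# Kato's elliptic units `_𝔞z_{p^s𝔣}`: NORM-COMPATIBILITY of the representatives up to 12th roots of unity —
# `N_{K(p^{s+1}𝔣)/K(p^s𝔣)} u′ = ζ · u`, `ζ^{12} = 1` (the (N)-element input of Johnson-Leung–Kings' pin (Z1)),
# from de Shalit II.2.5 (i) / II.2.4 (i)

Cell `bsd-print-cf2` (HOME `run/shared/lean/pub/bsd-print-cf2/`), width seat `bsd-line-cf2-p1-w2` g17, piece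
(O1) "N-elt" of `bsd-line-cf2-p1-w5` g9's F0b breakdown (planner g20 re-allocation 14:52:10Z), second file
(sequel of `PrintCf2RubinValueTwoKatoThetaNormChain.lean`); `--supports` the deciding child
stmt-BirchSwinnertonDyer-24721 of crux 20368. THEOREMS ONLY, Theses-free; CONDITIONAL on the named facts
`DeShalit1987.prop25_i_normRelation` and `DeShalit1987.prop24_i_mem_rayClassField` (published).

PRINT. Kato §15.5 (p. 253): the `(_𝔞z_{pⁿ𝔣})_n` form "a norm compatible system" ("deduced from (15.4.2)");
Johnson-Leung–Kings Prop. 3.3 (2): "`N_{K(𝔮𝔪)/K(𝔪)} ζ_{𝔮𝔪} = ζ_𝔪` for `𝔮 ∣ p𝔪`". At the level of the tree's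
REPRESENTATIVES (`IsKatoUnitRep p ι 𝔣 s 𝔞 u`: a `p`-unit `u` of `K(p^s𝔣)` with `ι̂(u)^{12} = Θ(1; p^s𝔣, 𝔞)`,
determined up to `μ₁₂` only) this reads: `N_{K(p^{s+1}𝔣)/K(p^s𝔣)}(u′)^{12} = N(u′^{12})`, and
`ι̂(N(u′^{12})) = Θ(1; p^s𝔣, 𝔞) = ι̂(u^{12})` by de Shalit II.2.5 (i) iterated along the prime chain
`p^s𝔣 ⊃ p^s𝔣𝔩₁ ⊃ ⋯ ⊃ p^{s+1}𝔣`, `(p) = 𝔩₁⋯𝔩_r` (every `𝔩_j ∣ p ∣ p^s𝔣` for `s ≥ 1`: the branch `𝔩 ∣ 𝔣`;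
exponents `e = 1` at rigid levels) — the sibling's `KatoThetaNorm.algClosureEmb_normOver_chain` — so
`N(u′) = ζ·u` with `ζ^{12} = 1`.

WHAT IS PROVED: `exists_list_primes_prod_eq_span` (`(p) = 𝔩₁⋯𝔩_r`, a non-empty list of non-zero primes of
`𝓞_K`), `katoModulus_succ_eq` (`p^{s+1}𝔣 = p^s𝔣 · (p)`), **`exists_normOver_katoUnitRep_eq_mul`** (one rigid
level `s ≥ 1`) and **`exists_forall_normOver_katoUnitRep`** (`∃ s₁, ∀ s ≥ s₁, ∀ 𝔞 u u′ …` — the shape asked by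
`-w5 g9`, rigidity discharged by the tree's `exists_forall_unitsInjectiveMod_katoModulus`).
HONEST FRAMING: bookkeeping over two published named facts; nothing about an elliptic curve; BSD not advanced.

## References
* [Kato2004Asterisque] K. Kato, Astérisque 295 (2004), §15.5 (p. 253: "(_𝔞z_{pⁿ𝔣})_n … norm compatible").
* [JohnsonLeungKings2011] J. Johnson-Leung, G. Kings, J. reine angew. Math. 653 (2011), Prop. 3.3 (2)
  (arXiv:0804.2828 p0009:L122–p0010:L10).
* [deShalit1987] E. de Shalit (1987), II.2.4 (i), II.2.5 (i) (p. 44–48).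
-/

set_option linter.dupNamespace false -- `Summit.BirchSwinnertonDyer.BirchSwinnertonDyer` (summit = problem) is the tree's layout
set_option autoImplicit false

noncomputable section

open scoped Classical
open Field NumberField IsDedekindDomain
open Literature.NumberTheory.NumberFields (rayClassField)
open Literature.NumberTheory.GaloisRepresentations
open Literature.NumberTheory.EllipticCurves
open Literature.NumberTheory.ComplexMultiplication.EllipticUnits
open Summit.BirchSwinnertonDyer.BirchSwinnertonDyer.Theorems.PrintCf2.LeopoldtAtV
open Summit.BirchSwinnertonDyer.BirchSwinnertonDyer.Theorems.PrintCf2.KatoThetaNorm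

namespace Summit.BirchSwinnertonDyer.BirchSwinnertonDyer.Theorems.PrintCf2.KatoUnitRepNorm

variable {K : Type} [Field K] [NumberField K] (p : ℕ) [Fact p.Prime] (𝔣 : Ideal (𝓞 K))

/-- **`(p) = 𝔩₁⋯𝔩_r` in `𝓞_K`**: a NON-EMPTY list of non-zero prime ideals with product `(p)` (the normalized
factorisation in the Dedekind domain `𝓞_K`; non-empty because `p` is not a unit). [cite: NeukirchANT1999, Ch. I §3 Thm. (3.3)] -/
theorem exists_list_primes_prod_eq_span :
    ∃ l : List (Ideal (𝓞 K)), l ≠ [] ∧ (∀ I ∈ l, I.IsPrime ∧ I ≠ ⊥) ∧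
      l.prod = Ideal.span {((p : ℕ) : 𝓞 K)} := by
  have hM0 : (Ideal.span {((p : ℕ) : 𝓞 K)} : Ideal (𝓞 K)) ≠ ⊥ := span_natCast_prime_ne_bot p
  have hM1 : (Ideal.span {((p : ℕ) : 𝓞 K)} : Ideal (𝓞 K)) ≠ ⊤ := by
    have h := katoModulus_ne_top p (⊤ : Ideal (𝓞 K)) (le_refl 1)
    rwa [katoModulus_one, Ideal.mul_top] at h
  refine ⟨(UniqueFactorizationMonoid.normalizedFactors (Ideal.span {((p : ℕ) : 𝓞 K)})).toList, ?_, ?_, ?_⟩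
  · intro h
    rw [Multiset.toList_eq_nil] at h
    have hpos := (UniqueFactorizationMonoid.normalizedFactors_pos _ hM0).mpr
      (by rwa [Ideal.isUnit_iff])
    rw [h] at hpos
    exact lt_irrefl _ hpos
  · intro I hI
    rw [Multiset.mem_toList] at hI
    have hp := UniqueFactorizationMonoid.prime_of_normalized_factor I hI
    exact ⟨Ideal.isPrime_of_prime hp, hp.ne_zero⟩
  · rw [Multiset.prod_toList, Ideal.prod_normalizedFactors_eq_self hM0]

omit [NumberField K] [Fact p.Prime] in
/-- `p^{s+1}𝔣 = p^s𝔣 · (p)`. [cite: Kato2004Asterisque, §15.1 (p. 250)] -/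
theorem katoModulus_succ_eq (s : ℕ) :
    katoModulus p 𝔣 (s + 1) = katoModulus p 𝔣 s * Ideal.span {((p : ℕ) : 𝓞 K)} := by
  rw [katoModulus, katoModulus, pow_succ, mul_right_comm]

/-- **NORM-COMPATIBILITY OF KATO'S REPRESENTATIVES UP TO `μ₁₂`, at one rigid level `s ≥ 1`**: for `K` imaginary
quadratic, `O_K^× ↪ (O_K/p^s𝔣)^×`, an admissible twist `𝔞` and representatives `u` (level `s`), `u′` (level
`s+1`) of Kato's unit: **`N_{K(p^{s+1}𝔣)/K(p^s𝔣)} u′ = ζ · u` with `ζ^{12} = 1`** (read in `K̄`; `normOver`).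
[cite: deShalit1987, II.2.5 Proposition (i) and II.2.4 Proposition (i)] [cite: Kato2004Asterisque, §15.5 (p. 253)]
[cite: JohnsonLeungKings2011, Prop. 3.3 (2) (arXiv p0009:L122–p0010:L10)] -/
theorem exists_normOver_katoUnitRep_eq_mul (h25 : DeShalit1987.prop25_i_normRelation)
    (h24i : DeShalit1987.prop24_i_mem_rayClassField) (hK : IsImaginaryQuadratic K) (ι : K →+* ℂ)
    (h𝔣 : 𝔣 ≠ ⊥) {s : ℕ} (hs : 1 ≤ s) (hrig : UnitsInjectiveMod (katoModulus p 𝔣 s))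
    {𝔞 : Ideal (𝓞 K)} (h𝔞 : IsTwist p 𝔣 𝔞) {u u' : (AlgebraicClosure K)ˣ}
    (hu : IsKatoUnitRep p ι 𝔣 s 𝔞 u) (hu' : IsKatoUnitRep p ι 𝔣 (s + 1) 𝔞 u')
    (hu'F : (u' : AlgebraicClosure K) ∈ katoLayer p 𝔣 (s + 1)) :
    ∃ ζ : AlgebraicClosure K, ζ ^ 12 = 1 ∧
      ((normOver (katoLayer p 𝔣 (s + 1)) (katoLayer p 𝔣 s) ⟨(u' : AlgebraicClosure K), hu'F⟩ :
        katoLayer p 𝔣 (s + 1)) : AlgebraicClosure K) = ζ * (u : AlgebraicClosure K) := by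
  obtain ⟨l, hl0, hlprime, hlprod⟩ := exists_list_primes_prod_eq_span (K := K) p
  obtain ⟨-, L, La, S, hL, hLa, hS, hθu⟩ := hu
  obtain ⟨-, L', La', S', hL', hLa', hS', hθu'⟩ := hu'
  -- the moduli `𝔤 = p^s𝔣` and `p^{s+1}𝔣 = 𝔤 · ∏ l`
  have hM : katoModulus p 𝔣 (s + 1) = katoModulus p 𝔣 s * l.prod := by rw [hlprod, katoModulus_succ_eq]
  have h𝔤0 : katoModulus p 𝔣 s ≠ ⊥ := katoModulus_ne_bot p 𝔣 h𝔣 s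
  have h𝔤1 : katoModulus p 𝔣 s ≠ ⊤ := katoModulus_ne_top p 𝔣 hs
  have hdvd : ∀ I ∈ l, I ∣ katoModulus p 𝔣 s := fun I hI ↦ by
    have h1 : I ∣ Ideal.span {((p : ℕ) : 𝓞 K)} := hlprod ▸ List.dvd_prod hI
    rw [katoModulus]
    exact h1.trans (dvd_mul_of_dvd_left (dvd_pow_self _ (by omega)) _)
  have h𝔞0 : 𝔞 ≠ ⊥ := ne_bot_of_isCoprime_katoModulus p 𝔣 h𝔞.isCoprime_katoModulus_one
  have h𝔞c : IsCoprime 𝔞 (katoModulus p 𝔣 s * l.prod) := hM ▸ h𝔞.isCoprime_katoModulus p 𝔣 (s + 1)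
  have hL'' : ∀ w : ℂ, w ∈ L'.lattice ↔ ∃ a ∈ katoModulus p 𝔣 s * l.prod, w = ι (a : K) := by
    rw [← hM]; exact hL'
  -- the element `z = u′^{12}` of the top layer
  have hz : (u' : AlgebraicClosure K) ^ 12 ∈ rayClassField K (katoModulus p 𝔣 s * l.prod) := by
    rw [← hM]; exact pow_mem hu'F 12
  have hchain := algClosureEmb_normOver_chain h25 h24i hK ι l hl0 hlprime h𝔤0 h𝔤1 hrig hdvd h𝔞0 h𝔞c hL hLa hS
    hL'' hLa' hS' hz hθu'
  rw [← hθu] at hchain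
  have h12 : ((normOver (rayClassField K (katoModulus p 𝔣 s * l.prod)) (rayClassField K (katoModulus p 𝔣 s))
      ⟨(u' : AlgebraicClosure K) ^ 12, hz⟩ : rayClassField K (katoModulus p 𝔣 s * l.prod)) : AlgebraicClosure K) =
      (u : AlgebraicClosure K) ^ 12 := (algClosureEmb ι).injective hchain
  -- back to the layers `K(p^{s+1}𝔣) ≥ K(p^s𝔣)` and the 12th power of the norm
  have hle : katoLayer p 𝔣 s ≤ katoLayer p 𝔣 (s + 1) := katoLayer_mono p 𝔣 h𝔣 (Nat.le_succ s)
  have hpow : ((normOver (katoLayer p 𝔣 (s + 1)) (katoLayer p 𝔣 s) ⟨(u' : AlgebraicClosure K), hu'F⟩ :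
      katoLayer p 𝔣 (s + 1)) : AlgebraicClosure K) ^ 12 = (u : AlgebraicClosure K) ^ 12 := by
    rw [← h12, coe_normOver_congr (congrArg (rayClassField K) hM) rfl (pow_mem hu'F 12) hz |>.symm]
    change _ = ((normOver (katoLayer p 𝔣 (s + 1)) (katoLayer p 𝔣 s)
      (⟨(u' : AlgebraicClosure K), hu'F⟩ ^ 12) : katoLayer p 𝔣 (s + 1)) : AlgebraicClosure K)
    rw [normOver_pow hle]
    rfl
  have hu0 : (u : AlgebraicClosure K) ≠ 0 := u.ne_zero
  refine ⟨((normOver (katoLayer p 𝔣 (s + 1)) (katoLayer p 𝔣 s) ⟨(u' : AlgebraicClosure K), hu'F⟩ :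
      katoLayer p 𝔣 (s + 1)) : AlgebraicClosure K) / (u : AlgebraicClosure K), ?_, ?_⟩
  · rw [div_pow, hpow, div_self (pow_ne_zero _ hu0)]
  · rw [div_mul_cancel₀ _ hu0]

/-- **THE (N)-ELEMENT INPUT OF THE ZETA PIN, in the shape `∃ s₁, ∀ s ≥ s₁, ∀ 𝔞 u u′ …`**: for `K` imaginary
quadratic and `𝔣 ≠ 0` there is `s₁` such that for all `s ≥ s₁`, all admissible twists `𝔞` and all
representatives `u` (level `s`), `u′` (level `s+1`): `N_{K(p^{s+1}𝔣)/K(p^s𝔣)} u′ = ζ · u`, `ζ^{12} = 1` (rigidity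
of the levels `≥ s₁` by `exists_forall_unitsInjectiveMod_katoModulus`).
[cite: deShalit1987, II.2.5 Proposition (i) and II.2.4 Proposition (i)] [cite: Kato2004Asterisque, §15.5 (p. 253)]
[cite: JohnsonLeungKings2011, Prop. 3.3 (2) (arXiv p0009:L122–p0010:L10)] -/
theorem exists_forall_normOver_katoUnitRep (h25 : DeShalit1987.prop25_i_normRelation)
    (h24i : DeShalit1987.prop24_i_mem_rayClassField) (hK : IsImaginaryQuadratic K) (ι : K →+* ℂ)
    (h𝔣 : 𝔣 ≠ ⊥) :
    ∃ s₁ : ℕ, ∀ s : ℕ, s₁ ≤ s → ∀ 𝔞 : Ideal (𝓞 K), IsTwist p 𝔣 𝔞 →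
      ∀ u u' : (AlgebraicClosure K)ˣ, IsKatoUnitRep p ι 𝔣 s 𝔞 u → IsKatoUnitRep p ι 𝔣 (s + 1) 𝔞 u' →
      ∀ hu' : (u' : AlgebraicClosure K) ∈ katoLayer p 𝔣 (s + 1),
        ∃ ζ : AlgebraicClosure K, ζ ^ 12 = 1 ∧
          ((normOver (katoLayer p 𝔣 (s + 1)) (katoLayer p 𝔣 s) ⟨(u' : AlgebraicClosure K), hu'⟩ :
            katoLayer p 𝔣 (s + 1)) : AlgebraicClosure K) = ζ * (u : AlgebraicClosure K) := by
  obtain ⟨n₀, hn₀⟩ := exists_forall_unitsInjectiveMod_katoModulus hK (Fact.out : p.Prime) 𝔣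
  refine ⟨n₀ + 1, fun s hs 𝔞 h𝔞 u u' hu hu' hu'F ↦ ?_⟩
  exact exists_normOver_katoUnitRep_eq_mul p 𝔣 h25 h24i hK ι h𝔣 (by omega) (hn₀ s (by omega)) h𝔞 hu hu' hu'F

end Summit.BirchSwinnertonDyer.BirchSwinnertonDyer.Theorems.PrintCf2.KatoUnitRepNorm
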